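import Mathlib
import HarnessLib
import Summits.CriticalPhenomena.PercolationContinuityZ3.Theses.PercLowPointHalfSpace
import Summits.CriticalPhenomena.PercolationContinuityZ3.Theorems.PercLowPointHalfSpaceAssemblyWallExit

/-!
# Route `PercLowPointHalfSpace`, item `Assembly`: floor-run refinement of the wall-exit lemma

Helper file for item `stmt-CriticalPhenomena-0915` (`Assembly`) of route
`CriticalPhenomena/PercLowPointHalfSpace`, refining `LowPoint.exists_wall_exit`
(`PercLowPointHalfSpaceAssemblyWallExit.lean`).

* `LowPoint.exists_exit_prefix_within` — first exit of a walk from a vertex set, keeping the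
  prefix inside the set.
* `LowPoint.exists_floor_run_exit` — if `a, b ∈ ℍ₊ = {1 ≤ x₀}`, `a ↔ b in ℍ = {0 ≤ x₀}` but not
  in `ℍ₊`, and `B = C_{ℍ₊}(a)` is the bush of `a`, then there are floor vertices `u ≠ u'` with:
  root edge `s(u, u+e₀)` open and `u + e₀ ∈ B`; an open path from `u` to `u'` running ON THE
  FLOOR `{x₀ = 0}`; root edge `s(u', u'+e₀)` open with `u' + e₀ ∉ B` (so the bush of `u'` is
  DISJOINT from `B`); and `u' + e₀ ↔ b` in `ℍ ∖ B`.

So every configuration of the column event `E_t^{(n)}` of the route's bookkeeping contains two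
DISJOINT bushes whose roots are joined by an open floor path — the exact place where floor bond
percolation at `p_c(ℤ³) < 1/2` (`FloorSubcritical`, proved) and a repulsion estimate for two
disjoint bushes at root separation `dist(u, u')` (crux A is the case `dist = 1`) enter; the
remaining piece `u' + e₀ ↔ b in ℍ ∖ B` may again leave the second bush (chains).

Sources: G. Grimmett, *Percolation* (1999), §7.2 p. 148 (paths "in `A`"); elementary.
-/

noncomputable section

namespace Summit.CriticalPhenomena.PercolationContinuityZ3.Theorems

open MeasureTheory Filter Topology
open Literature.Probability.Percolation Literature.Probability.LatticeModels
open scoped ENNReal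

namespace LowPoint

variable {d : ℕ}

/-! ## The avoiding arm runs along the floor, then climbs a disjoint bush -/

section FloorRun

variable {V : Type*}

/-- First exit from a set `T` along a walk, keeping the prefix inside `T`: if `x ∈ T` and
`y ∉ T`, there is a step `c → c'` of the walk with `c ∈ T`, `c' ∉ T`, the walk from `x` to `c`
running inside `T`, and `c'` joined to `y` by the rest of the walk. [folklore] -/
theorem exists_exit_prefix_within {G : SimpleGraph V} {T : Set V} {x y : V} (p : G.Walk x y)
    (hx : x ∈ T) (hy : y ∉ T) :
    ∃ c c' : V, c ∈ T ∧ c' ∉ T ∧ G.Adj c c' ∧ (G ⊓ withinGraph ⊤ T).Reachable x c ∧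
      G.Reachable c' y := by
  induction p with
  | nil => exact (hy hx).elim
  | @cons a b e h p ih =>
    by_cases hb : b ∈ T
    · obtain ⟨c, c', hc, hc', hadj, hpre, hsuf⟩ := ih hb hy
      refine ⟨c, c', hc, hc', hadj, ?_, hsuf⟩
      have hab : (G ⊓ withinGraph ⊤ T).Adj a b :=
        ⟨h, (SimpleGraph.top_adj a b).2 h.ne, hx, hb⟩
      exact hab.reachable.trans hpre
    · exact ⟨a, b, hx, hb, h, SimpleGraph.Reachable.refl _, ⟨p⟩⟩

end FloorRun

section FloorRunExit

variable [NeZero d]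

/-- **Floor-run refinement of the wall-exit lemma.** Let `ω` open only lattice edges,
`a, b ∈ ℍ₊`, `a ↔ b in ℍ` but not in `ℍ₊`, and `B = C_{ℍ₊}(a)` the bush of `a`. Then there are
floor vertices `u, u'` with: the root edge `s(u, u + e₀)` open and `u + e₀ ∈ B`; `u ↔ u'` by an
open path running ON THE FLOOR `{x₀ = 0}`; the root edge `s(u', u' + e₀)` open with
`u' + e₀ ∉ B` (so the bush `C_{ℍ₊}(u' + e₀)` is disjoint from `B`, and `u' ≠ u`); and
`u' + e₀ ↔ b in ℍ ∖ B`. (The avoiding arm of `exists_wall_exit` stays on the floor until its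
first step up, which is a root edge into a bush other than `B`.) This is the exact place where
the floor percolation (`FloorSubcritical`) and a two-DISJOINT-bush repulsion at root separation
`dist(u, u')` enter any bookkeeping. [folklore] -/
theorem exists_floor_run_exit {ω : BondConfig (Site d)} (hω : ω ⊆ (zdGraph d).edgeSet)
    {a b : Site d} (ha : 1 ≤ a 0) (hb : 1 ≤ b 0)
    (hab : ω ∈ openConnIn {x : Site d | 0 ≤ x 0} a b)
    (hab' : ω ∉ openConnIn {x : Site d | 1 ≤ x 0} a b) :
    ∃ u u' : Site d, u 0 = 0 ∧ u' 0 = 0 ∧ s(u, u + Pi.single 0 1) ∈ ω ∧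
      ω ∈ openConnIn {x : Site d | 1 ≤ x 0} a (u + Pi.single 0 1) ∧
      ω ∈ openConnIn {x : Site d | x 0 = 0} u u' ∧
      s(u', u' + Pi.single 0 1) ∈ ω ∧
      ω ∉ openConnIn {x : Site d | 1 ≤ x 0} a (u' + Pi.single 0 1) ∧
      ω ∈ openConnIn ({x : Site d | 0 ≤ x 0} \ {x | ω ∈ openConnIn {x : Site d | 1 ≤ x 0} a x})
        (u' + Pi.single 0 1) b := by
  obtain ⟨u, hu0, hroot, hbush, havoid⟩ := exists_wall_exit hω ha hab hab'
  set S : Set (Site d) := {x : Site d | 0 ≤ x 0} \ {x | ω ∈ openConnIn {x : Site d | 1 ≤ x 0} a x}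
    with hS
  set T : Set (Site d) := {x : Site d | x 0 = 0} with hT
  have huS : u ∈ S := havoid.1
  have hbT : b ∉ T := by
    change ¬ b 0 = 0
    omega
  -- the avoiding walk from `u` to `b`, and its first step off the floor
  have hreach : (openGraph ω ⊓ withinGraph ⊤ S).Reachable u b :=
    mem_openClusterIn_iff.1 ((conn_iff_mem_cluster huS).1 havoid)
  obtain ⟨c, c', hcT, hc'T, hadj, hpre, hsuf⟩ := exists_exit_prefix_within hreach.some hu0 hbT
  rw [SimpleGraph.inf_adj, openGraph_adj, withinGraph_adj] at hadj
  obtain ⟨⟨hopen, hne⟩, -, hcS, hc'S⟩ := hadj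
  -- the step `c → c'` is the root edge at `c`
  have hlat : (zdGraph d).Adj c c' := by
    have := hω hopen
    rwa [SimpleGraph.mem_edgeSet] at this
  have hc'0 : 0 ≤ c' 0 := hc'S.1
  have hcT' : c 0 = 0 := hcT
  have hc'eq : c' = c + Pi.single 0 1 := by
    obtain ⟨i, hi | hi⟩ := (zdGraph_adj_iff c c').1 hlat
    · rcases eq_or_ne i 0 with rfl | hi0
      · exact hi
      · exfalso
        have h0 := congrFun hi 0
        rw [Pi.add_apply, Pi.single_eq_of_ne hi0.symm, add_zero] at h0
        exact hc'T (show c' 0 = 0 from h0.trans hcT')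
    · exfalso
      have h0 := congrFun hi 0
      rcases eq_or_ne i 0 with rfl | hi0
      · rw [Pi.add_apply, Pi.single_eq_same] at h0
        omega
      · rw [Pi.add_apply, Pi.single_eq_of_ne hi0.symm, add_zero] at h0
        exact hc'T (show c' 0 = 0 by omega)
  subst hc'eq
  refine ⟨u, c, hu0, hcT', hroot, hbush, ?_, hopen, hc'S.2, ?_⟩
  · -- the prefix runs on the floor: a walk of `openGraph ω ⊓ withinGraph ⊤ S ⊓ withinGraph ⊤ T`
    refine (conn_iff_mem_cluster (show u ∈ T from hu0)).2 (mem_openClusterIn_iff.2 ?_)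
    refine hpre.mono ?_
    exact le_inf (inf_le_left.trans inf_le_left) inf_le_right
  · -- the suffix avoids the bush
    exact (conn_iff_mem_cluster hc'S).2 (mem_openClusterIn_iff.2 hsuf)

end FloorRunExit

end LowPoint

end Summit.CriticalPhenomena.PercolationContinuityZ3.Theorems

end
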